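import Mathlib
import Summits.MatrixMultiplication.Statement
import Summits.MatrixMultiplication.MatrixMultiplication.Theorems.GraphEquationsTestCount
import Summits.MatrixMultiplication.MatrixMultiplication.Theorems.GraphEquationsGenerators
import Summits.MatrixMultiplication.MatrixMultiplication.Theorems.GraphEquationsCoeffIdentity

/-!
# GraphEquations — the verification exponent `ω_v` and the route as two statements about one number
(M49; cell `decomp-mm`, lens-5 g40)

Helper kernel beneath the attacked crux `MultiplicityReduction` (stmt-MatrixMultiplication-27806) of
route `GraphEquations`.  Define the **verification exponent**
`ω_v := inf {β : correct equation systems for W_n of cost O(n^β) exist}` (`omegaVerif`).  Then,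
unconditionally,

* `two_le_omegaVerif`, `omegaVerif_le_omega`, `omegaVerif_lt` — **`2 ≤ ω_v ≤ ω < 2.48`** (lower bound:
  the degree-free test count of M48, `two_le_of_eqAdmissible`; upper bound: reduced systems from fast
  algorithms, `eqAdmissible(Red)_of_omega_lt`);
* `graphEquationsQuadratic_iff_omegaVerif_eq_two` — the RESIDUAL crux `V` **is** `ω_v = 2`;
* `equationsForceMultiplication_iff_omega_le_omegaVerif` / `_iff_omega_eq_omegaVerif` — piece `H`
  **is** `ω = ω_v`, and `omega_eq_omegaVerif_of_multiplicityReduction` — the ATTACKED crux `H_mult`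
  gives `ω = ω_v` (through the tree's theorem `H_red`);
* `matrixMultiplication_iff_omegaVerif` — the summit **is** `ω_v = 2 ∧ ω ≤ ω_v`;
* `multiplicityReduction_iff_unguarded` — the guard `2 ≤ β` in `H_mult` is automatic (M48).

So the route's two cruxes are the two halves `ω_v = 2` (construct cheap verifiers) and `ω ≤ ω_v`
(verifiers are algorithms), and M48 pins the dial: `ω_v` cannot drop below `2`.  Sorry-free; no stub
credit claimed.
-/

set_option linter.dupNamespace false
set_option linter.unusedSectionVars false

noncomputable section

namespace Summit.MatrixMultiplication.MatrixMultiplication.Theorems.GraphEquations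

open Literature.Computability.AlgebraicComplexity

/-- The set of admissible VERIFICATION exponents: `β` with correct systems of cost `O(n^β)`. -/
def verifExponents : Set ℝ := {β | EqAdmissible β}

/-- **The verification exponent `ω_v`** of matrix multiplication (equation systems for the graph). -/
def omegaVerif : ℝ := sInf verifExponents

/-- Membership in `verifExponents`. -/
theorem mem_verifExponents {β : ℝ} : β ∈ verifExponents ↔ EqAdmissible β := Iff.rfl

/-- `verifExponents` is non-empty (`5/2` is admissible, even with reduced systems). -/
theorem verifExponents_nonempty : verifExponents.Nonempty :=
  ⟨5 / 2, eqAdmissibleRed_five_halves.eqAdmissible⟩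

/-- `2` is a lower bound of `verifExponents` (M48). -/
theorem two_mem_lowerBounds_verifExponents : (2 : ℝ) ∈ lowerBounds verifExponents :=
  fun _ hβ => two_le_of_eqAdmissible hβ

/-- `verifExponents` is bounded below. -/
theorem verifExponents_bddBelow : BddBelow verifExponents := ⟨2, two_mem_lowerBounds_verifExponents⟩

/-- `verifExponents` is upward closed. -/
theorem mem_verifExponents_of_le {β β' : ℝ} (h : β ∈ verifExponents) (hle : β ≤ β') :
    β' ∈ verifExponents :=
  EqAdmissible.mono h hle

/-- **`2 ≤ ω_v`** (unconditional; M48). -/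
theorem two_le_omegaVerif : 2 ≤ omegaVerif :=
  le_csInf verifExponents_nonempty two_mem_lowerBounds_verifExponents

/-- `ω_v ≤ β` for every admissible `β`. -/
theorem omegaVerif_le_of_eqAdmissible {β : ℝ} (h : EqAdmissible β) : omegaVerif ≤ β :=
  csInf_le verifExponents_bddBelow h

/-- Every `β > ω_v` is admissible. -/
theorem eqAdmissible_of_omegaVerif_lt {β : ℝ} (h : omegaVerif < β) : EqAdmissible β := by
  obtain ⟨β', hβ', hlt⟩ := exists_lt_of_csInf_lt verifExponents_nonempty h
  exact EqAdmissible.mono hβ' hlt.le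

/-- **`ω_v ≤ ω`** (unconditional): fast algorithms give cheap (reduced) verifiers. -/
theorem omegaVerif_le_omega : omegaVerif ≤ omega ℂ :=
  le_of_forall_gt_imp_ge_of_dense fun _ hβ =>
    omegaVerif_le_of_eqAdmissible (eqAdmissibleRed_of_omega_lt hβ).eqAdmissible

/-- `ω_v ≤ 5/2` (unconditional). -/
theorem omegaVerif_le_five_halves : omegaVerif ≤ 5 / 2 :=
  omegaVerif_le_of_eqAdmissible eqAdmissibleRed_five_halves.eqAdmissible

/-- **`ω_v < 2.48`** (unconditional, through `ω < 2.48`). -/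
theorem omegaVerif_lt : omegaVerif < 2.48 :=
  omegaVerif_le_omega.trans_lt (BCS1997_cor_15_33 ℂ)

/-! ## The cruxes as statements about `ω_v` -/

/-- **`V ⟺ ω_v = 2`**: the residual crux `GraphEquationsQuadratic` is exactly `ω_v = 2`. -/
theorem graphEquationsQuadratic_iff_omegaVerif_eq_two : GraphEquationsQuadratic ↔ omegaVerif = 2 := by
  constructor
  · intro hV
    exact le_antisymm (le_of_forall_gt_imp_ge_of_dense fun β hβ =>
      omegaVerif_le_of_eqAdmissible (hV β hβ)) two_le_omegaVerif
  · intro h β hβ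
    exact eqAdmissible_of_omegaVerif_lt (by rw [h]; exact hβ)

/-- **`H ⟺ ω ≤ ω_v`**: «equations force multiplication» is exactly `ω ≤ ω_v`. -/
theorem equationsForceMultiplication_iff_omega_le_omegaVerif :
    EquationsForceMultiplication ↔ omega ℂ ≤ omegaVerif := by
  constructor
  · intro hH
    exact le_csInf verifExponents_nonempty fun β hβ => hH β (two_le_of_eqAdmissible hβ) hβ
  · intro h β _ hβ
    exact h.trans (omegaVerif_le_of_eqAdmissible hβ)

/-- **`H ⟺ ω = ω_v`.** -/
theorem equationsForceMultiplication_iff_omega_eq_omegaVerif :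
    EquationsForceMultiplication ↔ omega ℂ = omegaVerif :=
  ⟨fun h => le_antisymm (equationsForceMultiplication_iff_omega_le_omegaVerif.mp h) omegaVerif_le_omega,
    fun h => equationsForceMultiplication_iff_omega_le_omegaVerif.mpr h.le⟩

/-- **The guard `2 ≤ β` in `H_mult` is automatic** (M48): `MultiplicityReduction` is equivalent to its
unguarded form. -/
theorem multiplicityReduction_iff_unguarded :
    MultiplicityReduction ↔ ∀ β : ℝ, EqAdmissible β → ∀ β' : ℝ, β < β' → EqAdmissibleRed β' :=
  ⟨fun h β hβ => h β (two_le_of_eqAdmissible hβ) hβ, fun h β _ hβ => h β hβ⟩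

/-- **`H_mult ⟹ ω ≤ ω_v`** (through the tree's theorem `H_red`,
`reducedEquationsForceMultiplication_holds`). -/
theorem omega_le_omegaVerif_of_multiplicityReduction (hM : MultiplicityReduction) :
    omega ℂ ≤ omegaVerif := by
  refine le_csInf verifExponents_nonempty fun β hβ => ?_
  have h2 : 2 ≤ β := two_le_of_eqAdmissible hβ
  exact le_of_forall_gt_imp_ge_of_dense fun β' hβ' =>
    reducedEquationsForceMultiplication_holds β' (by linarith) (hM β h2 hβ β' hβ')

/-- **`H_mult ⟹ ω = ω_v`.** -/
theorem omega_eq_omegaVerif_of_multiplicityReduction (hM : MultiplicityReduction) :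
    omega ℂ = omegaVerif :=
  le_antisymm (omega_le_omegaVerif_of_multiplicityReduction hM) omegaVerif_le_omega

/-- **The summit is `ω_v = 2 ∧ ω ≤ ω_v`.** -/
theorem matrixMultiplication_iff_omegaVerif :
    _root_.MatrixMultiplication ↔ omegaVerif = 2 ∧ omega ℂ ≤ omegaVerif := by
  rw [_root_.MatrixMultiplication_iff]
  constructor
  · intro h
    have h2 : omegaVerif = 2 :=
      le_antisymm (omegaVerif_le_omega.trans h.le) two_le_omegaVerif
    exact ⟨h2, by rw [h, h2]⟩
  · rintro ⟨h2, hle⟩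
    exact le_antisymm (hle.trans h2.le) (omega_two_le (K := ℂ))

/-- **Unconditional window:** `ω_v ∈ [2, ω] ⊆ [2, 2.48)`. -/
theorem omegaVerif_mem_Icc : omegaVerif ∈ Set.Icc 2 (omega ℂ) := ⟨two_le_omegaVerif, omegaVerif_le_omega⟩

end Summit.MatrixMultiplication.MatrixMultiplication.Theorems.GraphEquations

end
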